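import Summits.NavierStokesRegularity.NavierStokesRegularity.Theorems.EfficiencyFloorRigidExitReferenceShadowingPalinstrophy
import HarnessLib

/-!
# Route `EfficiencyFloor`, support `RigidExit` (stmt-NavierStokesRegularity-25513) on the `ProductionEfficiencyDecay` ladder
# (stmt-NavierStokesRegularity-22866): THE DISSIPATION BUDGET of the reference flow — `ν∫Pal ≤ Z + C∫Z³`

Helper file (`--supports stmt-NavierStokesRegularity-22866`; line `efficiency_floor`). Item 3 of the (R-shadow) census (uniform Grönwall
exponent for the tree's RRS Thm 9.1) needs, besides the window ceiling on `Z` (p839813), a bound on the TIME-INTEGRATED PALINSTROPHY of the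
reference flow: Agmon gives `∫‖v‖²_∞ ≤ A²∫√(Z·Pal) ≤ A²√(sup Z · length · ∫Pal)`. With the palinstrophy now a continuous function of time on
every `[δ,T]` (p839992, `ReferenceFlow.continuousOn_palinstrophy`), the enstrophy budget integrates:

* `deriv_le_of_admissible` — Young with HALF the dissipation: `2S − 2νPal ≤ (27c⁴/(16ν³))·Z³ − ν·Pal` for an admissible constant `c`;
* `dissipation_budget` — along the reference flow (classical on `(0,T]`, Sobolev bounds of `v`, `∂ₜv` on every `[δ,T]`), for
  `0 < a < b < T`: `Pal` is integrable on `[a,b]` and `ν·∫_a^b Pal ≤ Z(a) − Z(b) + (27c⁴/(16ν³))·∫_a^b Z³`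
  (`intervalIntegral.integral_le_sub_of_hasDeriv_right_of_le` on `g = −Z`).

HONEST FRAMING: bookkeeping; (R-shadow), `RigidExit`, `NearMaximiserBoundedAmplification`, `LerayFloorGap`, `ProductionEfficiencyDecay`
(stmt-22866) and Navier–Stokes regularity stay OPEN; no summit statement is proved. [folklore]
-/

-- the problem directory repeats the summit name (`NavierStokesRegularity/NavierStokesRegularity`)
set_option linter.dupNamespace false

noncomputable section

open Set Filter MeasureTheory Topology Function intervalIntegral
open scoped InnerProductSpace RealInnerProductSpace ENNReal NNReal ContDiff
open Literature.Analysis.FluidPDE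

namespace Summit.NavierStokesRegularity.NavierStokesRegularity.Theorems

namespace RigidExit

namespace ReferenceFlow

open ProductionEfficiencyDecay.LuDoeringRung (young_envelope)

section Dissipation

variable {ν T : ℝ} {v : ℝ → EuclideanSpace ℝ (Fin 3) → EuclideanSpace ℝ (Fin 3)} {q : ℝ → EuclideanSpace ℝ (Fin 3) → ℝ}

/-- **Young with half the dissipation.** If `S ≤ c·Z^{3/4}·P^{3/4}` (`Z, P ≥ 0`, `ν > 0`) then
`2S − 2νP ≤ (27c⁴/(16ν³))·Z³ − ν·P`. [cite: LuDoering2008, eq. (6)] -/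
theorem deriv_le_of_admissible {c Z P S : ℝ} (hν : 0 < ν) (hZ : 0 ≤ Z) (hP : 0 ≤ P)
    (hS : S ≤ c * Z ^ (3 / 4 : ℝ) * P ^ (3 / 4 : ℝ)) :
    2 * S - 2 * ν * P ≤ 27 * c ^ 4 / (16 * ν ^ 3) * Z ^ 3 - ν * P := by
  have hy := young_envelope (c := c) (half_pos hν) hZ hP
  have heq : 27 * c ^ 4 / (128 * (ν / 2) ^ 3) = 27 * c ^ 4 / (16 * ν ^ 3) := by
    field_simp
    ring
  rw [heq] at hy
  linarith

/-- **The dissipation budget of the reference flow.** Along `(v,q)` classical on `(0,T]` with Sobolev bounds of `v` and `∂ₜv` on every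
`[δ,T]`, for an admissible Lu–Doering constant `c` and `0 < a < b < T`: the palinstrophy `t ↦ ∫|∇curl v(t)|²_F` is integrable on
`[a,b]` and `ν·∫_a^b Pal ≤ Z(a) − Z(b) + (27c⁴/(16ν³))·∫_a^b Z(t)³ dt`. [cite: LuDoering2008, eq. (6)] -/
theorem dissipation_budget (hν : 0 < ν) (hcl : IsClassicalNSSolutionOn (Ioc 0 T) ν 0 v q)
    (hB : ∀ δ : ℝ, 0 < δ → δ ≤ T → HasBoundedSobolevNormsOn (Icc δ T) v)
    (hBt : ∀ δ : ℝ, 0 < δ → δ ≤ T → HasBoundedSobolevNormsOn (Icc δ T) (timeDerivWithin (Ioc 0 T) v))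
    {c : ℝ}
    (hc : ∀ w : EuclideanSpace ℝ (Fin 3) → EuclideanSpace ℝ (Fin 3), (ContDiff ℝ (⊤ : ℕ∞) w ∧
      VectorCalculus.IsDivFree w ∧ (∫⁻ x, ‖iteratedFDeriv ℝ 0 w x‖ₑ ^ 2 < ⊤) ∧
      (∫⁻ x, ‖iteratedFDeriv ℝ 1 w x‖ₑ ^ 2 < ⊤) ∧ (∫⁻ x, ‖iteratedFDeriv ℝ 2 w x‖ₑ ^ 2 < ⊤)) →
      (∫ x, ⟪curl w x, fderiv ℝ w x (curl w x)⟫_ℝ) ≤ c * (∫ x, ‖curl w x‖ ^ 2) ^ (3 / 4 : ℝ) *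
        (∫ x, frobeniusNormSq (fderiv ℝ (curl w) x)) ^ (3 / 4 : ℝ))
    {a b : ℝ} (ha : 0 < a) (hab : a < b) (hbT : b < T) :
    IntegrableOn (fun t => ∫ x, frobeniusNormSq (fderiv ℝ (curl (v t)) x)) (Icc a b) ∧
      ν * (∫ t in a..b, ∫ x, frobeniusNormSq (fderiv ℝ (curl (v t)) x)) ≤
        (∫ x, ‖curl (v a) x‖ ^ 2) - (∫ x, ‖curl (v b) x‖ ^ 2) +
          27 * c ^ 4 / (16 * ν ^ 3) * ∫ t in a..b, (∫ x, ‖curl (v t) x‖ ^ 2) ^ 3 := by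
  set Z : ℝ → ℝ := fun t => ∫ x, ‖curl (v t) x‖ ^ 2 with hZdef
  set Pal : ℝ → ℝ := fun t => ∫ x, frobeniusNormSq (fderiv ℝ (curl (v t)) x) with hPal
  set C' : ℝ := 27 * c ^ 4 / (16 * ν ^ 3) with hC'
  have hT : 0 < T := ha.trans (hab.trans hbT)
  -- continuity of `Pal` and `Z` on `[a, b]`
  have hPalc : ContinuousOn Pal (Icc a b) :=
    (continuousOn_palinstrophy hcl hB hBt ha (hab.trans hbT)).mono (Icc_subset_Icc_right hbT.le)
  have hZc : ContinuousOn Z (Icc a b) := fun t ht =>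
    (enstrophy_continuousAt hν hcl hB ⟨ha.trans_le ht.1, ht.2.trans_lt hbT⟩).continuousWithinAt
  have hPalI : IntegrableOn Pal (Icc a b) := hPalc.integrableOn_Icc
  have hZ3I : IntegrableOn (fun t => Z t ^ 3) (Icc a b) := (hZc.pow 3).integrableOn_Icc
  refine ⟨hPalI, ?_⟩
  -- `φ = ν Pal − C' Z³ ≤ (−Z)'`
  have hφI : IntegrableOn (fun t => ν * Pal t - C' * Z t ^ 3) (Icc a b) :=
    (hPalI.const_mul ν).sub (hZ3I.const_mul C')
  have hderiv : ∀ t ∈ Ioo a b, HasDerivWithinAt (fun s => -Z s)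
      (-(2 * (∫ x, ⟪curl (v t) x, fderiv ℝ (v t) x (curl (v t) x)⟫_ℝ) - 2 * ν * Pal t)) (Ioi t) t := fun t ht =>
    ((budget hν hcl hB hc ⟨ha.trans ht.1, ht.2.trans hbT⟩).1.neg).hasDerivWithinAt
  have hle : ∀ t ∈ Ioo a b, ν * Pal t - C' * Z t ^ 3 ≤
      -(2 * (∫ x, ⟪curl (v t) x, fderiv ℝ (v t) x (curl (v t) x)⟫_ℝ) - 2 * ν * Pal t) := by
    intro t ht
    have htI : t ∈ Ioo 0 T := ⟨ha.trans ht.1, ht.2.trans hbT⟩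
    have hadm := slice_admissible hcl hB ⟨htI.1, htI.2.le⟩
    have hZ0 : 0 ≤ Z t := integral_nonneg fun x => by positivity
    have hP0 : 0 ≤ Pal t := integral_nonneg fun x => frobeniusNormSq_nonneg _
    have h := deriv_le_of_admissible (c := c) hν hZ0 hP0 (hc (v t) hadm)
    simp only [hZdef, hPal, hC'] at h ⊢
    linarith
  have hmain := integral_le_sub_of_hasDeriv_right_of_le hab.le hZc.neg hderiv hφI hle
  -- unpack `∫ (νPal − C'Z³) = ν∫Pal − C'∫Z³`
  have hPi : IntervalIntegrable Pal volume a b := hPalc.intervalIntegrable_of_Icc hab.le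
  have hZ3i : IntervalIntegrable (fun t => Z t ^ 3) volume a b := (hZc.pow 3).intervalIntegrable_of_Icc hab.le
  have hsplit : (∫ t in a..b, (ν * Pal t - C' * Z t ^ 3)) = ν * (∫ t in a..b, Pal t) - C' * ∫ t in a..b, Z t ^ 3 := by
    rw [intervalIntegral.integral_sub (hPi.const_mul ν) (hZ3i.const_mul C'), intervalIntegral.integral_const_mul,
      intervalIntegral.integral_const_mul]
  rw [hsplit] at hmain
  simp only [Pi.neg_apply] at hmain
  have h' : ν * (∫ t in a..b, Pal t) - C' * (∫ t in a..b, Z t ^ 3) ≤ Z a - Z b := by linarith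
  show ν * (∫ t in a..b, Pal t) ≤ Z a - Z b + C' * ∫ t in a..b, Z t ^ 3
  linarith

end Dissipation

end ReferenceFlow

end RigidExit

end Summit.NavierStokesRegularity.NavierStokesRegularity.Theorems

end
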